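import Summits.ResolutionOfSingularities.ResolutionOfSingularities.Theorems.PurelyInseparableDim4LoopELocalEscapeUniform
import Summits.ResolutionOfSingularities.ResolutionOfSingularities.Theorems.PurelyInseparableDim4UniformSources
import HarnessLib

/-!
# [OURS · res-dim4-pi · F4-C-loc] LOOP-E over every field of characteristic 3 WITHOUT `√−1`: the whole region is a
  local A-win for the lone plane; over fields WITH `√−1` exactly the state `e3` has non-origin replies

Cell `res-dim4-pi` (D-0157 DOOR 2, wave 2), seat `res-dim4-p-6` g2; completes the LOOP-E all-fields picture begun in
`…LoopELocalEscapeUniform` (roots `e0, e1, e4` over all `L`; `e2` reduces to `e3`) and `…UniformSources` (p670166: at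
`e3` the `x₁²`-coefficient of the `x₁`-chart point transform is `β² + β⁴`, so `β = ±i` replies over `L ∋ i`).

* §0 generic: the vanishing of a certified multi-source coefficient at an equimultiple point
  (`sum_sourceTerm_eq_zero_of_isEquimultiplePoint`), and scope-free forms of the two win combinators (A's move is
  legal iff the lifted state is in scope; if it is not, the position is won outright — the same case split as the
  `𝔽₃` checker `rWins_of_rrowOK`).
* §1 certificates (‖ K over `𝔽₃`): at `e3`, plane `V(x₁,x₃)`: `x₁`-chart, `x₁²` has exactly the sources `x₁²x₃²`,
  `x₁²x₃⁴` (coefficient `β² + β⁴ = β²(1+β²)`); `x₃`-chart, `x₃²` has exactly the sources `x₁x₃²`, `x₁³x₃²`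
  (coefficient `β + β³ = β(1+β²)`); the `x₁`-origin child forces the origin in both charts (`x₁x₃ ← x₁x₃²`,
  `x₁x₃ ← x₁²x₃`, binomial `2`), its two children and the `x₃`-origin child of `e3` have maximal witnesses; the same
  for the `x₂`-free twin `g3`.
* §2 over every field `L` of characteristic 3 in which `−1` is not a square (`𝔽₃`, `𝔽₂₇`, …, any `𝔽_{3^odd}`, their
  transcendental extensions …): **`rWins_e3_allFields_of_no_sqrt`**, hence **`rWins_e2_allFields_of_no_sqrt`** and
  **`loopE_localWins_allFields_of_no_sqrt : ∀ s ∈ trapSet eR, RWins 3 localB (liftState L s)`** (and `gR`).  With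
  `UniformNoReply.exists_nonorigin_local_reply_e3` this is a DICHOTOMY BY `√−1 ∈ L`: the `𝔽₃` certificate of LOOP-E
  lifts verbatim exactly to the fields without `√−1`; over `𝔽₉` B has the extra replies `β = ±i` at `e3` (both
  charts) and whether A still wins locally there is NOT decided here.

Scope (honest): the LOCAL game `RWins 3 localB` at located states of OUR frame; F4-C-loc(3,3) in its ∃-rule form stays
OPEN.  [OURS · counted 0 · kernel certificates + symbolic coefficient law; AI kernel work, weaker than expert review.]
NOTHING here is a statement about resolution of singularities; resolution in dimension `≥ 4` / characteristic `p > 0`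
is NOT proved by anything in this file.  bears_on: LADDER-RESOLUTION:D157-DOOR2 (res-dim4-pi · F4-C-loc(3,3) all
fields · C-LOOP-E).  Host item (DR-157-C): `stmt-ResolutionOfSingularities-16155`, helper.
-/

set_option linter.dupNamespace false -- mandated namespace of this single-conjunct summit

noncomputable section

open MvPolynomial Finset
open scoped BigOperators

namespace Summit.ResolutionOfSingularities.ResolutionOfSingularities.Theorems.PIDim4

namespace LoopCLocal

open Literature.AlgebraicGeometry.Resolution
open Literature.AlgebraicGeometry.Resolution.CentreBlowup
open StepKit LoopC UniformNoReply

/-! ## §0 Generic bricks -/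

section Generic

variable (L : Type) [Field L] [CharP L 3]

/-- **At an equimultiple point every certified low coefficient vanishes**: the sum of the Taylor terms of the
sources of `x^γ` (`γ ≠ 0`, `|γ| < q`) is `0`. OURS. [folklore] -/
theorem sum_sourceTerm_eq_zero_of_isEquimultiplePoint {q : ℕ} {S T : Finset (Fin 4)} {j : Fin 4}
    {s : SData 4 (ZMod 3)} {γ : Fin 4 → ℕ} {E : List (Fin 4 → ℕ)} (h : sourcesB q S j T s.L γ E = true)
    (h0 : γ ≠ 0) (hdeg : (∑ i, γ i) < q) {b : Fin 4 → L} (hb : ∀ m : Fin 4, m ∉ T → b m = 0)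
    (heq : IsEquimultiplePoint q S j b (liftState L s.toState)) :
    (E.map (sourceTerm (φ3 L) (chartL q S j s.L) γ b)).sum = 0 := by
  rw [← coeff_pointTransform_of_sourcesB (φ3 L) h hb]
  exact heq (expo γ) ((not_congr (expo_eq_zero_iff γ)).mpr h0) (by rw [degree_expo]; exact hdeg)

/-- legality of A's move at a lifted state from the scope over `L` and the `𝔽₃` permissibility check.
OURS. [folklore] -/
theorem legal_lift' {s : SData 4 (ZMod 3)} (hsc : InCoordinateScope 3 (liftState L s.toState).F)
    {S : Finset (Fin 4)} (hperm : permB 3 S s.L = true) :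
    InCoordinateScope 3 (liftState L s.toState).F ∧ IsPermissibleCentre 3 S (liftState L s.toState).F :=
  ⟨hsc, (BaseChange.isPermissibleCentre_map_iff (φ3 L) 3 S s.toState.F).mpr
    ((isPermissibleCentre_iff 3 S s.L).mpr hperm)⟩

variable [DecidableEq L]

/-- **Win by witnesses, scope-free form**: maximal witnesses in every chart of a permissible centre make the lifted
state a local A-win — if it is in scope A plays the centre (no reply), if not the position is won outright.
OURS. [folklore] -/
theorem rWins_allFields_of_witnesses' {s : SData 4 (ZMod 3)} {S : Finset (Fin 4)} (hperm : permB 3 S s.L = true)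
    (w : Fin 4 → Fin 4 → ℕ) (hw : ∀ j ∈ S, uniformWitnessB 3 S j (S.erase j) s.L (w j) = true) :
    RWins 3 localB (liftState L s.toState) := by
  by_cases hsc : InCoordinateScope 3 (liftState L s.toState).F
  · exact Game.Wins.move (m := S) (legal_lift' L hsc hperm)
      fun _ ⟨j, b, hj, hbj, hloc, heq, _, _⟩ =>
        absurd heq (not_isEquimultiplePoint_of_uniformWitnessB (φ3 L) (hw j hj)
          (vanish_erase L hbj ((localB_eq_true_iff _ j b).mp hloc)))
  · exact Game.Wins.terminal fun _ hS' => hsc hS'.1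

/-- **Plane root forcing the origin in both charts, scope-free form.** OURS. [folklore] -/
theorem rWins_lift_of_forcesOrigin_pair' {a c : Fin 4} {s : SData 4 (ZMod 3)} (hperm : permB 3 {a, c} s.L = true)
    {γa ea γc ec : Fin 4 → ℕ} (ha : forcesOriginB 3 {a, c} a s.L γa ea = true)
    (hc : forcesOriginB 3 {a, c} c s.L γc ec = true)
    (hwa : RWins 3 localB (liftState L (stepD 3 {a, c} a 0 s).toState))
    (hwc : RWins 3 localB (liftState L (stepD 3 {a, c} c 0 s).toState)) : RWins 3 localB (liftState L s.toState) := by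
  by_cases hsc : InCoordinateScope 3 (liftState L s.toState).F
  · refine Game.Wins.move (m := ({a, c} : Finset (Fin 4))) (legal_lift' L hsc hperm) ?_
    rintro s' ⟨j, b, hj, hbj, hloc, heq, -, rfl⟩
    have hb := (localB_eq_true_iff _ j b).mp hloc
    rcases mem_pair hj with rfl | rfl
    · obtain rfl := local_reply_eq_zero_of_forcesOriginB L ha hbj hb heq
      rw [step_origin_lift]
      exact hwa
    · obtain rfl := local_reply_eq_zero_of_forcesOriginB L hc hbj hb heq
      rw [step_origin_lift]
      exact hwc
  · exact Game.Wins.terminal fun _ hS' => hsc hS'.1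

omit [CharP L 3] [DecidableEq L] in
/-- `β²(1 + β²) = 0` without `√−1`: `β = 0`. OURS. [folklore] -/
theorem eq_zero_of_sq_add_fourth (hL : ∀ i : L, i * i ≠ -1) {β : L} (h : β ^ 2 + β ^ 4 = 0) : β = 0 := by
  have h' : β ^ 2 * (1 + β ^ 2) = 0 := by linear_combination h
  rcases mul_eq_zero.mp h' with h2 | h2
  · exact pow_eq_zero_iff (two_ne_zero) |>.mp h2
  · exact absurd (by linear_combination h2 : β * β = -1) (hL β)

omit [CharP L 3] [DecidableEq L] in
/-- `β(1 + β²) = 0` without `√−1`: `β = 0`. OURS. [folklore] -/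
theorem eq_zero_of_self_add_cube (hL : ∀ i : L, i * i ≠ -1) {β : L} (h : β + β ^ 3 = 0) : β = 0 := by
  have h' : β * (1 + β ^ 2) = 0 := by linear_combination h
  rcases mul_eq_zero.mp h' with h2 | h2
  · exact h2
  · exact absurd (by linear_combination h2 : β * β = -1) (hL β)

end Generic

/-! ## §1 The certificates over `𝔽₃` -/

/-- `e3`, plane `V(x₁,x₃)`, `x₁`-chart: the sources of `x₁²` are exactly `x₁²x₃²` and `x₁²x₃⁴`, both with
coefficient `1`. [OURS · ‖ K] -/
theorem src_e3_x1 :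
    sourcesB 3 {0, 2} 0 (({0, 2} : Finset (Fin 4)).erase 0) e3.L ![2, 0, 0, 0] [![2, 0, 2, 0], ![2, 0, 4, 0]] = true ∧
      coeffAt (chartL 3 {0, 2} 0 e3.L) ![2, 0, 2, 0] = 1 ∧ coeffAt (chartL 3 {0, 2} 0 e3.L) ![2, 0, 4, 0] = 1 := by
  refine ⟨?_, ?_, ?_⟩ <;> decide +kernel

/-- `e3`, `x₃`-chart: the sources of `x₃²` are exactly `x₁x₃²` and `x₁³x₃²`, both with coefficient `1`.
[OURS · ‖ K] -/
theorem src_e3_x3 :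
    sourcesB 3 {0, 2} 2 (({0, 2} : Finset (Fin 4)).erase 2) e3.L ![0, 0, 2, 0] [![1, 0, 2, 0], ![3, 0, 2, 0]] = true ∧
      coeffAt (chartL 3 {0, 2} 2 e3.L) ![1, 0, 2, 0] = 1 ∧ coeffAt (chartL 3 {0, 2} 2 e3.L) ![3, 0, 2, 0] = 1 := by
  refine ⟨?_, ?_, ?_⟩ <;> decide +kernel

/-- the `x₁`-origin child of `e3`: both charts force the origin (`x₁x₃` from `x₁x₃²` resp. `x₁²x₃`, binomial `2`);
permissibility of the plane at it and at its two origin children and at the `x₃`-origin child of `e3`; maximal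
witnesses `x₃²`/`x₁`, `x₃`/`x₁²`, `x₃²`/`x₁` there. [OURS · ‖ K] -/
theorem certs_e3tree :
    forcesOriginB 3 {0, 2} 0 (stepD 3 {0, 2} 0 0 e3).L ![1, 0, 1, 0] ![1, 0, 2, 0] = true ∧
    forcesOriginB 3 {0, 2} 2 (stepD 3 {0, 2} 0 0 e3).L ![1, 0, 1, 0] ![2, 0, 1, 0] = true ∧
    permB 3 {0, 2} (stepD 3 {0, 2} 0 0 e3).L = true ∧
    permB 3 {0, 2} (stepD 3 {0, 2} 0 0 (stepD 3 {0, 2} 0 0 e3)).L = true ∧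
    permB 3 {0, 2} (stepD 3 {0, 2} 2 0 (stepD 3 {0, 2} 0 0 e3)).L = true ∧
    permB 3 {0, 2} (stepD 3 {0, 2} 2 0 e3).L = true ∧
    (∀ j ∈ ({0, 2} : Finset (Fin 4)), uniformWitnessB 3 {0, 2} j (({0, 2} : Finset (Fin 4)).erase j)
      (stepD 3 {0, 2} 0 0 (stepD 3 {0, 2} 0 0 e3)).L (![![0, 0, 2, 0], ![0, 0, 0, 0], ![1, 0, 0, 0], ![0, 0, 0, 0]] j) =
        true) ∧
    (∀ j ∈ ({0, 2} : Finset (Fin 4)), uniformWitnessB 3 {0, 2} j (({0, 2} : Finset (Fin 4)).erase j)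
      (stepD 3 {0, 2} 2 0 (stepD 3 {0, 2} 0 0 e3)).L (![![0, 0, 1, 0], ![0, 0, 0, 0], ![2, 0, 0, 0], ![0, 0, 0, 0]] j) =
        true) ∧
    (∀ j ∈ ({0, 2} : Finset (Fin 4)), uniformWitnessB 3 {0, 2} j (({0, 2} : Finset (Fin 4)).erase j)
      (stepD 3 {0, 2} 2 0 e3).L (![![0, 0, 2, 0], ![0, 0, 0, 0], ![1, 0, 0, 0], ![0, 0, 0, 0]] j) = true) := by
  refine ⟨?_, ?_, ?_, ?_, ?_, ?_, ?_, ?_, ?_⟩ <;> decide +kernel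

/-- LOOP-E′: the same certificates at `g3`. [OURS · ‖ K] -/
theorem certs_g3tree :
    (sourcesB 3 {0, 2} 0 (({0, 2} : Finset (Fin 4)).erase 0) g3.L ![2, 0, 0, 0] [![2, 0, 2, 0], ![2, 0, 4, 0]] = true ∧
      coeffAt (chartL 3 {0, 2} 0 g3.L) ![2, 0, 2, 0] = 1 ∧ coeffAt (chartL 3 {0, 2} 0 g3.L) ![2, 0, 4, 0] = 1) ∧
    (sourcesB 3 {0, 2} 2 (({0, 2} : Finset (Fin 4)).erase 2) g3.L ![0, 0, 2, 0] [![1, 0, 2, 0], ![3, 0, 2, 0]] = true ∧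
      coeffAt (chartL 3 {0, 2} 2 g3.L) ![1, 0, 2, 0] = 1 ∧ coeffAt (chartL 3 {0, 2} 2 g3.L) ![3, 0, 2, 0] = 1) ∧
    forcesOriginB 3 {0, 2} 0 (stepD 3 {0, 2} 0 0 g3).L ![1, 0, 1, 0] ![1, 0, 2, 0] = true ∧
    forcesOriginB 3 {0, 2} 2 (stepD 3 {0, 2} 0 0 g3).L ![1, 0, 1, 0] ![2, 0, 1, 0] = true ∧
    permB 3 {0, 2} (stepD 3 {0, 2} 0 0 g3).L = true ∧
    permB 3 {0, 2} (stepD 3 {0, 2} 0 0 (stepD 3 {0, 2} 0 0 g3)).L = true ∧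
    permB 3 {0, 2} (stepD 3 {0, 2} 2 0 (stepD 3 {0, 2} 0 0 g3)).L = true ∧
    permB 3 {0, 2} (stepD 3 {0, 2} 2 0 g3).L = true ∧
    (∀ j ∈ ({0, 2} : Finset (Fin 4)), uniformWitnessB 3 {0, 2} j (({0, 2} : Finset (Fin 4)).erase j)
      (stepD 3 {0, 2} 0 0 (stepD 3 {0, 2} 0 0 g3)).L (![![0, 0, 2, 0], ![0, 0, 0, 0], ![1, 0, 0, 0], ![0, 0, 0, 0]] j) =
        true) ∧
    (∀ j ∈ ({0, 2} : Finset (Fin 4)), uniformWitnessB 3 {0, 2} j (({0, 2} : Finset (Fin 4)).erase j)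
      (stepD 3 {0, 2} 2 0 (stepD 3 {0, 2} 0 0 g3)).L (![![0, 0, 1, 0], ![0, 0, 0, 0], ![2, 0, 0, 0], ![0, 0, 0, 0]] j) =
        true) ∧
    (∀ j ∈ ({0, 2} : Finset (Fin 4)), uniformWitnessB 3 {0, 2} j (({0, 2} : Finset (Fin 4)).erase j)
      (stepD 3 {0, 2} 2 0 g3).L (![![0, 0, 2, 0], ![0, 0, 0, 0], ![1, 0, 0, 0], ![0, 0, 0, 0]] j) = true) := by
  refine ⟨⟨?_, ?_, ?_⟩, ⟨?_, ?_, ?_⟩, ?_, ?_, ?_, ?_, ?_, ?_, ?_, ?_, ?_⟩ <;> decide +kernel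

/-! ## §2 Over every field of characteristic 3 without `√−1` -/

section NoSqrt

variable (L : Type) [Field L] [CharP L 3] [DecidableEq L]

omit [DecidableEq L] in
/-- **At the lifted `e3` (or `g3`), without `√−1`, every equimultiple `L`-point over the current point is a chart
origin** — from the two two-source certificates. OURS. [folklore] -/
theorem local_reply_eq_zero_of_twoSources (hL : ∀ i : L, i * i ≠ -1) {s : SData 4 (ZMod 3)}
    (h1 : sourcesB 3 {0, 2} 0 (({0, 2} : Finset (Fin 4)).erase 0) s.L ![2, 0, 0, 0] [![2, 0, 2, 0], ![2, 0, 4, 0]] =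
        true ∧
      coeffAt (chartL 3 {0, 2} 0 s.L) ![2, 0, 2, 0] = 1 ∧ coeffAt (chartL 3 {0, 2} 0 s.L) ![2, 0, 4, 0] = 1)
    (h3 : sourcesB 3 {0, 2} 2 (({0, 2} : Finset (Fin 4)).erase 2) s.L ![0, 0, 2, 0] [![1, 0, 2, 0], ![3, 0, 2, 0]] =
        true ∧
      coeffAt (chartL 3 {0, 2} 2 s.L) ![1, 0, 2, 0] = 1 ∧ coeffAt (chartL 3 {0, 2} 2 s.L) ![3, 0, 2, 0] = 1)
    {j : Fin 4} (hj : j ∈ ({0, 2} : Finset (Fin 4))) {b : Fin 4 → L} (hbj : b j = 0)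
    (hb : ∀ m : Fin 4, m ∉ ({0, 2} : Finset (Fin 4)) → b m = 0)
    (heq : IsEquimultiplePoint 3 {0, 2} j b (liftState L s.toState)) : b = 0 := by
  have hb1 : b 1 = 0 := hb 1 (by decide)
  have hb3 : b 3 = 0 := hb 3 (by decide)
  rcases mem_pair hj with rfl | rfl
  · obtain ⟨hs, hc1, hc2⟩ := h1
    have hsum := sum_sourceTerm_eq_zero_of_isEquimultiplePoint L hs (by decide) (by decide)
      (vanish_erase L hbj hb) heq
    simp only [List.map_cons, List.map_nil, List.sum_cons, List.sum_nil, sourceTerm, hc1, hc2, map_one, one_mul,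
      add_zero] at hsum
    simp [Fin.prod_univ_four, hbj, hb1, hb3] at hsum
    have h2 : b 2 = 0 := eq_zero_of_sq_add_fourth L hL hsum
    funext m; fin_cases m <;> assumption
  · obtain ⟨hs, hc1, hc2⟩ := h3
    have hsum := sum_sourceTerm_eq_zero_of_isEquimultiplePoint L hs (by decide) (by decide)
      (vanish_erase L hbj hb) heq
    simp only [List.map_cons, List.map_nil, List.sum_cons, List.sum_nil, sourceTerm, hc1, hc2, map_one, one_mul,
      add_zero] at hsum
    simp [Fin.prod_univ_four, hbj, hb1, hb3] at hsum
    have h0 : b 0 = 0 := eq_zero_of_self_add_cube L hL hsum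
    funext m; fin_cases m <;> assumption

/-- the `x₁`-origin child of `e3` is a local A-win over every field of characteristic 3 (two moves). [OURS · ‖ K] -/
theorem rWins_e3c0_allFields : RWins 3 localB (liftState L (stepD 3 {0, 2} 0 0 e3).toState) :=
  rWins_lift_of_forcesOrigin_pair' L certs_e3tree.2.2.1 certs_e3tree.1 certs_e3tree.2.1
    (rWins_allFields_of_witnesses' L certs_e3tree.2.2.2.1 _ certs_e3tree.2.2.2.2.2.2.1)
    (rWins_allFields_of_witnesses' L certs_e3tree.2.2.2.2.1 _ certs_e3tree.2.2.2.2.2.2.2.1)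

/-- the `x₃`-origin child of `e3` is a local A-win over every field of characteristic 3 (no reply). [OURS · ‖ K] -/
theorem rWins_e3c2_allFields : RWins 3 localB (liftState L (stepD 3 {0, 2} 2 0 e3).toState) :=
  rWins_allFields_of_witnesses' L certs_e3tree.2.2.2.2.2.1 _ certs_e3tree.2.2.2.2.2.2.2.2

/-- **`e3` is a local A-win over every field of characteristic 3 WITHOUT `√−1`** (play `V(x₁,x₃)`; the replies
are the two chart origins; then as certified). [OURS · ‖ K] -/
theorem rWins_e3_allFields_of_no_sqrt (hL : ∀ i : L, i * i ≠ -1) : RWins 3 localB (liftState L e3.toState) := by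
  refine Game.Wins.move (m := ({0, 2} : Finset (Fin 4)))
    (legal_lift L (inCoordinateScope_toState_of_scopeCertB scope_eL3) (by decide +kernel)) ?_
  rintro s' ⟨j, b, hj, hbj, hloc, heq, -, rfl⟩
  obtain rfl := local_reply_eq_zero_of_twoSources L hL src_e3_x1 src_e3_x3 hj hbj
    ((localB_eq_true_iff _ j b).mp hloc) heq
  rw [step_origin_lift]
  rcases mem_pair hj with rfl | rfl
  · exact rWins_e3c0_allFields L
  · exact rWins_e3c2_allFields L

/-- **`e2` is a local A-win over every field of characteristic 3 without `√−1`.** [OURS · ‖ K] -/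
theorem rWins_e2_allFields_of_no_sqrt (hL : ∀ i : L, i * i ≠ -1) : RWins 3 localB (liftState L e2.toState) :=
  rWins_e2_allFields_of_e3 L (rWins_e3_allFields_of_no_sqrt L hL)

/-- **LOOP-E IS NO LOCAL PLAY OVER ANY FIELD OF CHARACTERISTIC 3 WITHOUT `√−1`**: every region state, lifted, is an
A-win of the local in-scope game for the lone plane. [OURS · ‖ K] -/
theorem loopE_localWins_allFields_of_no_sqrt (hL : ∀ i : L, i * i ≠ -1) :
    ∀ s ∈ trapSet eR, RWins 3 localB (liftState L s) := by
  rintro s ⟨sw, hsw, rfl⟩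
  simp only [eR, List.mem_cons, List.not_mem_nil, or_false] at hsw
  rcases hsw with rfl | rfl | rfl | rfl | rfl
  · exact rWins_e0_allFields L
  · exact rWins_e1_allFields L
  · exact rWins_e2_allFields_of_no_sqrt L hL
  · exact rWins_e3_allFields_of_no_sqrt L hL
  · exact rWins_e4_allFields L

/-- LOOP-E′: `g3` is a local A-win over every field of characteristic 3 without `√−1`. [OURS · ‖ K] -/
theorem rWins_g3_allFields_of_no_sqrt (hL : ∀ i : L, i * i ≠ -1) : RWins 3 localB (liftState L g3.toState) := by
  obtain ⟨h1, h3, hfa, hfc, hp0, hp00, hp02, hp2, hw00, hw02, hw2⟩ := certs_g3tree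
  refine Game.Wins.move (m := ({0, 2} : Finset (Fin 4)))
    (legal_lift L (inCoordinateScope_toState_of_scopeCertB scope_gL3) (by decide +kernel)) ?_
  rintro s' ⟨j, b, hj, hbj, hloc, heq, -, rfl⟩
  obtain rfl := local_reply_eq_zero_of_twoSources L hL h1 h3 hj hbj ((localB_eq_true_iff _ j b).mp hloc) heq
  rw [step_origin_lift]
  rcases mem_pair hj with rfl | rfl
  · exact rWins_lift_of_forcesOrigin_pair' L hp0 hfa hfc (rWins_allFields_of_witnesses' L hp00 _ hw00)
      (rWins_allFields_of_witnesses' L hp02 _ hw02)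
  · exact rWins_allFields_of_witnesses' L hp2 _ hw2

/-- **LOOP-E′ is no local play over any field of characteristic 3 without `√−1`.** [OURS · ‖ K] -/
theorem loopE'_localWins_allFields_of_no_sqrt (hL : ∀ i : L, i * i ≠ -1) :
    ∀ s ∈ trapSet gR, RWins 3 localB (liftState L s) := by
  rintro s ⟨sw, hsw, rfl⟩
  simp only [gR, List.mem_cons, List.not_mem_nil, or_false] at hsw
  rcases hsw with rfl | rfl | rfl | rfl | rfl
  · exact rWins_g0_allFields L
  · exact rWins_g1_allFields L
  · exact rWins_g2_allFields_of_g3 L (rWins_g3_allFields_of_no_sqrt L hL)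
  · exact rWins_g3_allFields_of_no_sqrt L hL
  · exact rWins_g4_allFields L

/-- **THE `√−1` DICHOTOMY FOR LOOP-E IN THE LOCAL GAME** (‖ K): over a field of characteristic 3 WITHOUT `√−1` the
whole region is a local A-win for the lone plane; over a field WITH `i`, `i² = −1`, the lifted `e3` has a local reply
off the chart origin (`(0,0,i,0)` in the `x₁`-chart) — the one place where the `𝔽₃` certificate does not lift.
[OURS · ‖ K] -/
theorem loopE_local_sqrt_dichotomy :
    ((∀ i : L, i * i ≠ -1) → ∀ s ∈ trapSet eR, RWins 3 localB (liftState L s)) ∧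
    ∀ i : L, i * i = -1 → ∃ b : Fin 4 → L, b ≠ 0 ∧ b 0 = 0 ∧
      (∀ m : Fin 4, m ∉ ({0, 2} : Finset (Fin 4)) → b m = 0) ∧ IsEquimultiplePoint 3 {0, 2} 0 b (liftState L e3.toState) :=
  ⟨loopE_localWins_allFields_of_no_sqrt L, fun _ hi => exists_nonorigin_local_reply_e3 L hi⟩

end NoSqrt

end LoopCLocal

end Summit.ResolutionOfSingularities.ResolutionOfSingularities.Theorems.PIDim4

end
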